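import Literature.Analysis.FluidPDE.TaoCascadeEquationsOfMotion
import Literature.Analysis.FluidPDE.TaoCascadeBlowupDynamicsHolds
import Literature.Analysis.FluidPDE.TaoAveragedComplexAverageLeaves
import Literature.Analysis.FluidPDE.TaoCascadeOfSingleScale
import Literature.Analysis.FluidPDE.TaoAveragedJointWeightProofs
import HarnessLib

/-!
# Tao's averaged Navier–Stokes blow-up: Theorems 3.3, 3.2 and 1.5 hold

T. Tao, *Finite time blowup for an averaged three-dimensional Navier–Stokes equation*,
J. Amer. Math. Soc. **29** (2016), 601–674 = arXiv:1402.0290v3 (held as `paper:arxiv-1402.0290`;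
all numbers are those of that text): Theorem 1.5 (p. 7), §3 p. 14 ("Theorem 1.5 is then an
immediate consequence of the following two results", Theorems 3.2 and 3.3), §4 (Thm 3.3 ⇐
Lemma 4.1 + Thm 4.2), §6.1 (Thm 4.2 ⇐ Thm 6.2), §3.1–§3.9 (proof of Thm 3.2).

This file records, in one place that co-imports the discharges, the end state of the in-tree
decomposition of Theorem 1.5 (`averagedNS_blowup`, `TaoAveragedSobolev.lean`). Theorems only; no
definitions, no new named facts: every declaration below is the discharge `X_holds : X` of a
named fact `X` stated (unchanged) in the file indicated.

* `localCascade_blowup_holds` — **Theorem 3.3 (blowup for a local cascade equation) holds**: the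
  named fact `localCascade_blowup` (`TaoAveragedCascade.lean`) discharged, by the accepted
  reduction `localCascade_blowup_of_noGlobalODESolution` (`TaoCascadeEquationsOfMotion.lean`:
  Lemma 4.1 `equationsOfMotion_holds` and §4/§6.1, Thm 3.3 ⇐ Thm 4.2 ⇐ Thm 6.2) fed with the
  accepted Theorem 6.2 `TaoCascade.noGlobalODESolution_holds` (`TaoCascadeBlowupDynamicsHolds.lean`,
  assembled from Props. 6.3–6.17). It cannot be appended to `TaoAveragedCascade.lean` itself
  (every module of the chain imports that file).
* `rotationAverage_tensorIdentity_holds`, `singleScale_isComplexAverageNoDil_holds`,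
  `localCascade_isComplexAverage_holds` — the integrated tensor identity **(3.13)**
  (`rotationAverage_tensorIdentity`), the single-scale dilation-free representation **(3.9)**
  (`singleScale_isComplexAverageNoDil`, §3.4 p. 17: "to finish the proof of Theorem 3.2, it
  suffices to show that `C₀` is a complex average of `B_{η,ρ,0}`") and the §3.1 p. 15 crux "every
  local cascade operator is a complex average of `B`" (`localCascade_isComplexAverage`), each by
  its accepted glue (`rotationAverage_tensorIdentity_of_steps`, resp. the `_of_jointWeight`
  reductions of `TaoAveragedComplexAverageLeaves.lean`) fed with the two §3.6–§3.9 leaves, now the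
  theorems `planeWaveSynthesis_holds` (§3.6, last paragraph) and `rotationAverage_jointWeight_holds`
  (§3.6 (3.14)–(3.16) with §3.7–§3.9; `TaoAveragedJointWeightProofs.lean`, over the data of
  `TaoAveragedJointWeightData.lean`); the third leaf `cascade_of_singleScale` (§3.4) is the theorem
  `cascade_of_singleScale_holds` (`TaoCascadeOfSingleScale.lean`).
* `localCascade_isAveraged_holds` — **Theorem 3.2 (local cascade operators are averaged Euler
  operators) holds**: `localCascade_isAveraged` (`TaoAveragedCascade.lean`) discharged by the
  accepted `localCascade_isAveraged_of_jointWeight` (`TaoAveragedComplexAverageLeaves.lean`: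
  Theorem 3.2 from the single fact `rotationAverage_jointWeight`, the other two leaves being
  theorems) applied to `rotationAverage_jointWeight_holds`.
* `averagedNS_blowup_holds` — **Theorem 1.5 holds**: "Theorem 1.5 is then an immediate consequence
  of [Theorems 3.2 and 3.3]" (`averagedNS_blowup_of_cascade`, §3 p. 14) applied to
  `localCascade_isAveraged_holds` and `localCascade_blowup_holds`; `exists_not_globalRegularity_holds`
  is its reformulation (`exists_not_globalRegularity_of_blowup`). No further decomposition of
  Theorem 1.5 is needed or possible along the printed proof; every step of it (§3.1–§3.9, §4, §5,
  §6) is a theorem of the tree.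

**Superseded conditional forms (removed 2026-08-15, dedup).** An earlier version of this file
also stated Theorem 3.2, Theorem 1.5 and its reformulation *conditionally* on the two then-open
§3.6–§3.9 leaves, as `localCascade_isAveraged_of_rotationLeaves (hA : planeWaveSynthesis)
(hB : rotationAverage_jointWeight)`, `averagedNS_blowup_of_rotationLeaves hA hB` and
`exists_not_globalRegularity_of_rotationLeaves hA hB`. Once `planeWaveSynthesis_holds` landed, the
first merely restated `localCascade_isAveraged_of_jointWeight hB` with a redundant hypothesis, and
with `rotationAverage_jointWeight_holds` all three are the unconditional `_holds` theorems below
with redundant hypotheses. They had no user outside this file and were removed; use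
`localCascade_isAveraged_of_jointWeight` (one hypothesis) or the `_holds` theorems. No statement of
a kept declaration changed.

## References

* T. Tao, J. Amer. Math. Soc. 29 (2016), 601–674 = arXiv:1402.0290v3, Thm. 1.5; §3 p. 14,
  Thms. 3.2, 3.3; §3.4–§3.9; §4 Lemma 4.1, Thm. 4.2; §6.1 Thm. 6.2. Key `Tao2016AveragedNS`.
-/

namespace Literature.Analysis.FluidPDE.Tao2016

/-- **Tao 2016, Theorem 3.3 (Blowup for a local cascade equation) holds**: for every
`0 < ε₀ < 1` there are a symmetric local cascade operator `C` with dyadic scale parameter `ε₀`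
obeying the cancellation property (3.2) and a Schwartz divergence-free `u₀` such that (3.3) has no
global mild solution `u : [0,+∞) → H¹⁰_df(ℝ³)` — the discharge of the named fact
`localCascade_blowup`, by the chain Thm 3.3 ⇐ Lemma 4.1 (`equationsOfMotion_holds`) + Thm 4.2 ⇐
Thm 6.2 (`TaoCascade.noGlobalODESolution_holds`), all links accepted. [cite: Tao2016AveragedNS, Thm. 3.3; §4 pp. 21–23; §6.1] -/
theorem localCascade_blowup_holds : localCascade_blowup :=
  localCascade_blowup_of_noGlobalODESolution TaoCascade.noGlobalODESolution_holds

/-! ### All leaves discharged: (3.13), (3.9), the §3.1 crux, Theorem 3.2 and Theorem 1.5 hold -/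

/-- **Tao 2016, §3.5 (3.13) holds (integrated form)**: for `ε₀` below an absolute threshold and
normalised profiles there is a dilation-free complex averaging datum whose frequency-side average
reproduces `∏ⱼ ∫ X̂ⱼ · \overline{ψ̂ⱼ}` on `H¹⁰_df ⊗ ℂ` — the discharge of
`rotationAverage_tensorIdentity`, from its two halves `planeWaveSynthesis_holds` (§3.6, last
paragraph) and `rotationAverage_jointWeight_holds` (§3.6–§3.9) by the accepted
`rotationAverage_tensorIdentity_of_steps`. [cite: Tao2016AveragedNS, §3.5 (3.13) and §3.6–3.9 (3.14)–(3.24) pp. 17–20] -/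
theorem rotationAverage_tensorIdentity_holds : rotationAverage_tensorIdentity :=
  rotationAverage_tensorIdentity_of_steps planeWaveSynthesis_holds rotationAverage_jointWeight_holds

/-- **Tao 2016, §3.4 (3.9) holds: `C₀` is a complex average of `B_{η,ρ,0}` without dilation
operators** (for `ε₀` below an absolute threshold and normalised profiles (3.7)) — the discharge of
the §3.5–§3.9 step fact `singleScale_isComplexAverageNoDil` (`TaoAveragedCascadeSteps.lean`), by the
accepted `singleScale_isComplexAverageNoDil_of_jointWeight` (§3.5 symbol extraction and the §3.6
plane-wave synthesis being theorems) applied to `rotationAverage_jointWeight_holds`. [cite: Tao2016AveragedNS, §3.4 (3.9) p. 17 and §3.5–3.9 pp. 17–20] -/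
theorem singleScale_isComplexAverageNoDil_holds : singleScale_isComplexAverageNoDil :=
  singleScale_isComplexAverageNoDil_of_jointWeight rotationAverage_jointWeight_holds

/-- **Tao 2016, §3.1 p. 15 / §3.2–§3.9: every local cascade operator is a complex average of the
Euler bilinear operator `B`** (for `ε₀` below an absolute threshold) — the discharge of the crux
`localCascade_isComplexAverage` (`TaoAveragedComplexAverage.lean`), all six step facts of
`TaoAveragedCascadeSteps.lean` being theorems (`localCascade_isComplexAverage_of_jointWeight`). [cite: Tao2016AveragedNS, §3.1 p. 15 and §3.2–3.9 pp. 15–20] -/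
theorem localCascade_isComplexAverage_holds : localCascade_isComplexAverage :=
  localCascade_isComplexAverage_of_jointWeight rotationAverage_jointWeight_holds

/-- **Tao 2016, Theorem 3.2 (local cascade operators are averaged Euler operators) holds**: for
`ε₀` below an absolute threshold, every local cascade form with dyadic scale parameter `ε₀` is
`⟨B̃_𝒜(u,v), w⟩` for an averaging datum `𝒜` ((1.12)–(1.13)) on `H¹⁰_df × H¹⁰_df × (H¹⁰_df ⊗ ℂ)` —
the discharge of `localCascade_isAveraged` (`TaoAveragedCascade.lean`) by
`localCascade_isAveraged_of_jointWeight` (Theorem 3.2 from the single fact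
`rotationAverage_jointWeight`, the leaves `planeWaveSynthesis` (§3.6) and `cascade_of_singleScale`
(§3.4) being theorems; `TaoAveragedComplexAverageLeaves.lean`) applied to
`rotationAverage_jointWeight_holds`. [cite: Tao2016AveragedNS, Thm. 3.2; §3.1–3.9 pp. 14–20] -/
theorem localCascade_isAveraged_holds : localCascade_isAveraged :=
  localCascade_isAveraged_of_jointWeight rotationAverage_jointWeight_holds

/-- **Tao 2016, Theorem 1.5 (Finite time blowup for an averaged Navier–Stokes equation) holds**:
there exist a symmetric averaged Euler bilinear operator `B̃` obeying the cancellation property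
(1.16) and a Schwartz divergence-free `u₀` such that the averaged Navier–Stokes equation (1.9)
has no global mild solution `u : [0,+∞) → H¹⁰_df(ℝ³)` — the discharge of `averagedNS_blowup`
(`TaoAveragedSobolev.lean`): "Theorem 1.5 is then an immediate consequence of [Theorems 3.2 and
3.3]" (`averagedNS_blowup_of_cascade` applied to `localCascade_isAveraged_holds` and
`localCascade_blowup_holds`). [cite: Tao2016AveragedNS, Thm. 1.5 p. 7; §3 p. 14] -/
theorem averagedNS_blowup_holds : averagedNS_blowup :=
  averagedNS_blowup_of_cascade localCascade_isAveraged_holds localCascade_blowup_holds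

/-- **Failure of global regularity for some symmetric averaged Euler operator with cancellation
holds** (Theorem 1.5 reformulated, `exists_not_globalRegularity`, `TaoAveragedSobolev.lean`), from
`averagedNS_blowup_holds` by `exists_not_globalRegularity_of_blowup`. [cite: Tao2016AveragedNS, Thm. 1.5 and p. 5] -/
theorem exists_not_globalRegularity_holds : exists_not_globalRegularity :=
  exists_not_globalRegularity_of_blowup averagedNS_blowup_holds

end Literature.Analysis.FluidPDE.Tao2016
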